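import Summits.Ventures.DiscreteObjects.UnitDistance.QuadraticPlanesFourJ
import Summits.Ventures.DiscreteObjects.UnitDistance.PlaneSqrt227Four
import Summits.Ventures.DiscreteObjects.UnitDistance.PlaneSqrt323Four
import Summits.Ventures.DiscreteObjects.UnitDistance.PlaneSqrt347Four
import Summits.Ventures.DiscreteObjects.UnitDistance.PlaneSqrt371Four
import Summits.Ventures.DiscreteObjects.UnitDistance.PlaneSqrt395Four
import HarnessLib

/-!
# Quadratic planes with chromatic number four, XI: `d = 227, 323, 347, 371, 395` by distance-two forcing; the ledger of open rows below `400`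
(cell `pub-namedobj`, target (U), seat udg g28 — summary)

Framing (verbatim for the cell): lottery ticket; floor = certified bounds/negative ranges.

Five more rows of the quadratic table are exact: `χ(ℚ(√d)²) = 4` for `d = 227, 323, 347, 371, 395` (`PlaneSqrt227Four.lean`,
`PlaneSqrt323Four.lean`, `PlaneSqrt347Four.lean`, `PlaneSqrt371Four.lean`, `PlaneSqrt395Four.lean`), all WITHOUT a 4-chromatic finite witness (udg g27's distance-two forcing,
`DistanceTwoForcing.lean`).  What changed (udg g28): (i) the worlds are found through the pair-pentagon criterion — a unit pentagon
`{u, ū′, v₁, v₂, v₃}` of `ℚ(√d)²` (two conjugate mixed vectors, three rational ones) exists iff the surface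
`r² = d · ((3 + ab)² + (a + b)²) · (3a²b² + 3a² + 3b² − 8ab − 5)` has a rational point (`a, b` the half-angle tangents of `v₁ v̄₃, v₂ v̄₃`);
the world of a row is 'all unit vectors whose denominator divides `L`', `L` the common denominator of one such pentagon (`110890`, `4930`,
`12818`, `18850`, `66130`); (ii) the test structure is the radius-`3` ball (`323`: `639,901` points) or the PENTAGON COMPLEX `P₂` — all unit pentagons through
the vertices of all unit pentagons through the origin (`347`: `90,909` points; `371`: `202,657`; `395`: `739,109`; `227`: `785,381`) — in which CDCL forces an antipodal pair at distance `2`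
apart (`(−1,0), (1,0)`; for `371` the pair `±(21,20)/29`, the axis pair not being a vertex of `P₂`); (iii) the gadgets that remain after LRAT-core rounds and proof-guided 'breathing' (`1359`, `1146`, `1468`, `579`, `1157` vertices)
are certified through their quotients `G/(P = Q)` by kernel RUP certificates in the light format of `KernelRupQuad.lean` (udg g18).

CONSEQUENCES.  `chromaticNumber_plane_multiSqrtField_eq_four_twentythree`: twenty-three exact rows with value four are now in the tree.
`quadratic_open_rows_lt_400''''`: the nine rows below `400` that are still not exact — `{3, 4}` for `83, 107`;
`{4, 5}` for `47, 143, 311, 335`; `[3, 5]` for `215, 383`; `[3, 7]` for `167`.  Values `≥ 4` not found in print (PROVISIONAL).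
-/

noncomputable section

namespace Summit.Ventures.DiscreteObjects.UnitDistance

open SimpleGraph IntermediateField
open scoped IntermediateField

/-- The twenty-one exact rows with value four now in the tree (`11, 23, 35, 59, 71, 95, 119, 131, 179, 191` of udg g12–g14; `239, 359` of udg g15;
`155, 203, 263` of udg g16; `287, 299` of udg g18; `251` of udg g27 and `227, 323, 347, 371, 395` of udg g28, by distance-two forcing), atlas vocabulary. -/
theorem chromaticNumber_plane_multiSqrtField_eq_four_twentythree :
    ∀ d ∈ ({11, 23, 35, 59, 71, 95, 119, 131, 155, 179, 191, 203, 227, 239, 251, 263, 287, 299, 323, 347, 359, 371, 395} : Finset ℕ),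
      (planeUnitDistanceGraph.induce (fieldPoints (multiSqrtField {d}))).chromaticNumber = 4 := by
  intro d hd
  simp only [Finset.mem_insert, Finset.mem_singleton] at hd
  rcases hd with rfl | rfl | rfl | rfl | rfl | rfl | rfl | rfl | rfl | rfl | rfl | rfl | rfl | rfl | rfl | rfl | rfl | rfl | rfl | rfl | rfl | rfl | rfl
  · exact chromaticNumber_plane_multiSqrtField_eq_four_eighteen 11 (by decide)
  · exact chromaticNumber_plane_multiSqrtField_eq_four_eighteen 23 (by decide)
  · exact chromaticNumber_plane_multiSqrtField_eq_four_eighteen 35 (by decide)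
  · exact chromaticNumber_plane_multiSqrtField_eq_four_eighteen 59 (by decide)
  · exact chromaticNumber_plane_multiSqrtField_eq_four_eighteen 71 (by decide)
  · exact chromaticNumber_plane_multiSqrtField_eq_four_eighteen 95 (by decide)
  · exact chromaticNumber_plane_multiSqrtField_eq_four_eighteen 119 (by decide)
  · exact chromaticNumber_plane_multiSqrtField_eq_four_eighteen 131 (by decide)
  · exact chromaticNumber_plane_multiSqrtField_eq_four_eighteen 155 (by decide)
  · exact chromaticNumber_plane_multiSqrtField_eq_four_eighteen 179 (by decide)
  · exact chromaticNumber_plane_multiSqrtField_eq_four_eighteen 191 (by decide)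
  · exact chromaticNumber_plane_multiSqrtField_eq_four_eighteen 203 (by decide)
  · exact chromaticNumber_plane_multiSqrtField_227
  · exact chromaticNumber_plane_multiSqrtField_eq_four_eighteen 239 (by decide)
  · exact chromaticNumber_plane_multiSqrtField_eq_four_eighteen 251 (by decide)
  · exact chromaticNumber_plane_multiSqrtField_eq_four_eighteen 263 (by decide)
  · exact chromaticNumber_plane_multiSqrtField_eq_four_eighteen 287 (by decide)
  · exact chromaticNumber_plane_multiSqrtField_eq_four_eighteen 299 (by decide)
  · exact chromaticNumber_plane_multiSqrtField_323
  · exact chromaticNumber_plane_multiSqrtField_347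
  · exact chromaticNumber_plane_multiSqrtField_eq_four_eighteen 359 (by decide)
  · exact chromaticNumber_plane_multiSqrtField_371
  · exact chromaticNumber_plane_multiSqrtField_395

/-- THE OPEN ROWS BELOW `400`, AMENDED (nine values; `227, 323, 347, 371, 395` are exact since this file): `3 ≤ χ ≤ 4` for `83, 107`;
`4 ≤ χ ≤ 5` for `47, 143, 311, 335`; `3 ≤ χ ≤ 5` for `215, 383`; `3 ≤ χ ≤ 7` for `167`.  Every other square-free `d ≡ 3 (mod 4)` below `400` has
`χ(ℚ(√d)²) = 3` (`d ≢ 2 (mod 3)`) or `= 4` (the twenty-three of `chromaticNumber_plane_multiSqrtField_eq_four_twentythree`). -/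
theorem quadratic_open_rows_lt_400'''' :
    (∀ d ∈ ({83, 107} : Finset ℕ),
        ¬ (planeUnitDistanceGraph.induce (fieldPoints (multiSqrtField {d}))).Colorable 2 ∧
          (planeUnitDistanceGraph.induce (fieldPoints (multiSqrtField {d}))).Colorable 4) ∧
    (∀ d ∈ ({47, 143, 311, 335} : Finset ℕ),
        4 ≤ (planeUnitDistanceGraph.induce (fieldPoints (multiSqrtField {d}))).chromaticNumber ∧
          (planeUnitDistanceGraph.induce (fieldPoints (multiSqrtField {d}))).chromaticNumber ≤ 5) ∧
    (∀ d ∈ ({215, 383} : Finset ℕ),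
        ¬ (planeUnitDistanceGraph.induce (fieldPoints (multiSqrtField {d}))).Colorable 2 ∧
          (planeUnitDistanceGraph.induce (fieldPoints (multiSqrtField {d}))).Colorable 5) ∧
    (¬ (planeUnitDistanceGraph.induce (fieldPoints (multiSqrtField {167}))).Colorable 2 ∧
      (planeUnitDistanceGraph.induce (fieldPoints (multiSqrtField {167}))).chromaticNumber ≤ 7) := by
  obtain ⟨h34, h45, h35, h167⟩ := quadratic_open_rows_lt_400'''
  refine ⟨?_, h45, h35, h167⟩
  intro d hd
  simp only [Finset.mem_insert, Finset.mem_singleton] at hd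
  rcases hd with rfl | rfl <;> exact h34 _ (by decide)

end Summit.Ventures.DiscreteObjects.UnitDistance
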